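import Summits.BirchSwinnertonDyer.BirchSwinnertonDyer.Theorems.PrintCFramBottomClassIndexLawFiveLeThetaCycleLegendre
import Mathlib.RingTheory.PowerSeries.NoZeroDivisors
import HarnessLib

/-!
# Crux `PrintCFram.BottomClassIndexLawFiveLe` (stmt-BirchSwinnertonDyer-20372), line `eisenstein-resource-bdp-line` (registry v21):
# THE θ-CYCLE ENGINE ON A PRODUCT `G · T` — the form is `(cut series) × θ₀(Q²z)^p`, and the conclusion is read on `G`
# (cell `bsd-print-cfram`, width seat `bsd-line-cfram-p1-w8` g6; THEOREMS ONLY, `--supports` 20372; BSD is not proved by any of this)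

HONEST FRAMING. Nothing here is a statement about elliptic curves, `L`-values or BSD; no registered stub is closed. This is §4 of
`…ThetaCycleLegendre` (p685354, this seat), split off for the 400-line cap. In the LEAD's derivation of `stub_atP`
(`Lines/eisenstein-resource-bdp-line-lead-g12.md` §3.4) the integral-weight form fed to the θ-cycle engine is a PRODUCT
`Φ₀ = G · θ₀^p` — `G` the `m`-cut Cohen–Eisenstein series (half-integral weight `k + 1/2`), `θ₀^p ≡ θ₀(q^p) (mod p)` — and what one
wants is a unit coefficient OF `G` in each Legendre class. This file performs that last bookkeeping step abstractly in `𝔽⟦X⟧`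
(`char 𝔽 = p`): if `T ≠ 0` is supported on exponents divisible by `p` (as `θ₀(q^{pQ²}) = ∑_b q^{pQ²b²}` is) and `G ≠ 0` has zero
constant term, then every non-zero coefficient of `G · T` at `N` comes from a non-zero coefficient of `G` at some `a ≡ N (mod p)`
(`exists_coeff_ne_zero_of_coeff_mul_ne_zero`), so the engine `ThetaCycle.exists_coeff_ne_zero_of_legendreSym_eq` applied to
`G · T ∈ M (k + (p+1)/2)` yields, for each `ε ∈ {±1}`, an index `a` with `(a/p) = ε` and `coeff a G ≠ 0`
(`exists_coeff_ne_zero_of_legendreSym_eq_of_mul_mem`). The filtration calculus (Katz 1973 Cor. 4.4.2, Katz 1977 Thm. (1)–(2),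
`M₀ =` constants) stays a HYPOTHESIS exactly as in the engine; nothing is discharged. With this file, `stub_atP` ⟸ «the reduction
mod `p` of the `m`-cut Cohen–Eisenstein series `G_e` satisfies: `G_e · θ₀(q^{pQ²}) ∈ M (k + (p+1)/2)` for a family `M` of mod-`p`
forms on `Γ₁(N)`, `p ∤ N`, with Katz's calculus» ∧ the elementary descent from an index `a` in the cut to an admissible field
(lead-g12 §3.3; next file of this seat). beyond-print theorem: NO.

References: [Katz1977] Thm. (1)–(2); [Katz1973] §4.4; [Cohen1975] Thm. 3.1; [AhlgrenBoylan2003] Thm. 3 (the printed θ₀^p device);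
crux notes `Lines/eisenstein-resource-bdp-line-lead-g12.md` §§3.3–3.4, 8.
-/

set_option autoImplicit false
-- summit-side namespace `Summit.BirchSwinnertonDyer.BirchSwinnertonDyer.…` (single-conjunct summit, D-0017 layout)
set_option linter.dupNamespace false

noncomputable section

open scoped Classical

namespace Summit.BirchSwinnertonDyer.BirchSwinnertonDyer.Theorems.PrintCFram.ThetaCycle

open PowerSeries

variable {𝔽 : Type*} [Field 𝔽]

/-! ## §4 Coefficients of a product with a `p`-supported factor -/

/-- **Support of a product with a `p`-supported factor.** In `𝔽⟦X⟧`, if every non-zero coefficient of `T` sits at an exponent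
divisible by `p`, then a non-zero coefficient of `G · T` at `N` forces a non-zero coefficient of `G` at some `a` with
`a ≡ N (mod p)` — hence in the same Legendre class at `p`. (For `T = θ₀(q^{pQ²})`: `supp(G·T) ⊆ {a + pQ²b² : a ∈ supp G}`,
lead-g12 §3.4.) [folklore] -/
theorem exists_coeff_ne_zero_of_coeff_mul_ne_zero {p : ℕ} [Fact p.Prime] {G T : PowerSeries 𝔽}
    (hTp : ∀ j : ℕ, coeff j T ≠ 0 → p ∣ j) {N : ℕ} (hN : coeff N (G * T) ≠ 0) :
    ∃ a : ℕ, coeff a G ≠ 0 ∧ legendreSym p a = legendreSym p N := by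
  rw [PowerSeries.coeff_mul] at hN
  obtain ⟨⟨i, j⟩, hij, hne⟩ := Finset.exists_ne_zero_of_sum_ne_zero hN
  rw [Finset.mem_antidiagonal] at hij
  obtain ⟨hi, hj⟩ := mul_ne_zero_iff.mp hne
  obtain ⟨c, hc⟩ := hTp j hj
  refine ⟨i, hi, ?_⟩
  rw [legendreSym.mod p (i : ℤ), legendreSym.mod p (N : ℤ)]
  have hN' : (N : ℤ) = i + p * c := by
    rw [← hij, hc]
    push_cast
    ring
  rw [hN', Int.add_mul_emod_self_left]

/-- **The θ-cycle engine on a product (the `θ₀^p` device of Ahlgren–Boylan / lead-g12 §3.4).** Under the hypotheses of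
`ThetaCycle.exists_coeff_ne_zero_of_legendreSym_eq` (a family `M j ⊆ 𝔽⟦q⟧` of «mod-`p` forms» with filtration `w` and `Θ = q d/dq`
satisfying Katz's calculus — all HYPOTHESES, nothing discharged), let `G, T ∈ 𝔽⟦X⟧` with `G · T ∈ M (k + (p+1)/2)`,
`k ∈ {(p+1)/4, (3p−1)/4}`, `G ≠ 0` with zero constant term, `T ≠ 0` supported on exponents divisible by `p`. Then for each
`ε ∈ {1, −1}` some coefficient of `G` in the Legendre class `ε` is non-zero. For the line: `G` = the `m`-cut Cohen–Eisenstein series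
mod `p`, `T = θ₀(q^{Q²})^p = θ₀(q^{pQ²})`; the conclusion is the «both Legendre classes carry a unit `H(k, n)`, `n` in the cut» step of
(AtP⁶). Not claimed: anything about BSD; no modular form is constructed here. [Katz1977, Thm. (1)–(2)] [Katz1973, §4.4]
[AhlgrenBoylan2003, Thm. 3] [Cohen1975, Thm. 3.1] -/
theorem exists_coeff_ne_zero_of_legendreSym_eq_of_mul_mem
    {p : ℕ} [Fact p.Prime] (h7 : 7 ≤ p) (hp4 : p % 4 = 3) [CharP 𝔽 p]
    (M : ℕ → Submodule 𝔽 (PowerSeries 𝔽)) (w : PowerSeries 𝔽 → ℕ)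
    (Θ : PowerSeries 𝔽 →ₗ[𝔽] PowerSeries 𝔽)
    (hΘ : ∀ (g : PowerSeries 𝔽) (n : ℕ), coeff n (Θ g) = (n : 𝔽) * coeff n g)
    (hfil : ∀ (g : PowerSeries 𝔽) (j : ℕ), g ∈ M j → g ≠ 0 → w g ≤ j ∧ (p - 1) ∣ (j - w g))
    (hfil_mem : ∀ (g : PowerSeries 𝔽) (j : ℕ), g ∈ M j → g ≠ 0 → g ∈ M (w g))
    (hM0 : ∀ g ∈ M 0, g = C (constantCoeff g))
    (hΘ_mem : ∀ (g : PowerSeries 𝔽) (j : ℕ), g ∈ M j → Θ g ∈ M (j + p + 1))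
    (hKatz : ∀ (g : PowerSeries 𝔽) (j : ℕ), g ∈ M j → g ≠ 0 → ¬ p ∣ w g →
      Θ g ≠ 0 ∧ w (Θ g) = w g + p + 1)
    {k : ℕ} (hk : k = (p + 1) / 4 ∨ k = (3 * p - 1) / 4)
    {G T : PowerSeries 𝔽} (hGT : G * T ∈ M (k + (p + 1) / 2)) (hG : G ≠ 0) (hG0 : constantCoeff G = 0)
    (hT : T ≠ 0) (hTp : ∀ j : ℕ, coeff j T ≠ 0 → p ∣ j)
    {ε : ℤ} (hε : ε = 1 ∨ ε = -1) :
    ∃ a : ℕ, legendreSym p a = ε ∧ coeff a G ≠ 0 := by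
  have hf0 : G * T ≠ 0 := mul_ne_zero hG hT
  have hc0 : constantCoeff (G * T) = 0 := by rw [map_mul, hG0, zero_mul]
  obtain ⟨N, hN, hcN⟩ := exists_coeff_ne_zero_of_legendreSym_eq h7 hp4 M w Θ hΘ hfil hfil_mem hM0 hΘ_mem
    hKatz hk hGT hf0 hc0 hε
  obtain ⟨a, ha, hleg⟩ := exists_coeff_ne_zero_of_coeff_mul_ne_zero (p := p) hTp hcN
  exact ⟨a, hleg.trans hN, ha⟩

end Summit.BirchSwinnertonDyer.BirchSwinnertonDyer.Theorems.PrintCFram.ThetaCycle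

end
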